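import Mathlib
import HarnessLib
import HarnessLib.Audit
import Summits.PneNP.Statement
import Literature.Probability.RandomGraphs.RandomRamsey
import Literature.Computability.MetaComplexity.SumOfSquares
import Literature.Computability.Complexity.GraphEncodings
import Literature.Computability.Complexity.Nondeterministic
import Literature.Computability.Complexity.NPBridge
import HarnessLib.Audit.Status.Attr

/-!
Route: RamseyThreshold

DORMANT since 2026-08-23T00:22:47Z (reconciler: no traction for 5.8 d (last activity item-evidence-added at 2026-08-17T04:54:01Z); parked, not closed — `ledger route dormant route-PneNP-RamseyThreshold --off` to reactivate) — unstaffed, not closed; items shared with open routes are served there. `ledger route dormant <id> --off` reactivates.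

# Route PneNP/RamseyThreshold — "random Ramsey arrowing is true one polynomial factor before any
efficient reasoner can certify it" (card PneNP/PneNP/ramsey-threshold-certification-gap; widen:
Ramsey theory of random structures × CSP refutation × sparse transference)

## Thesis X (it suffices to show) — the Random-Ramsey Hypothesis RRH₄
Words: for every 0 < δ < 1/15 there is NO deterministic polynomial-time predicate f on encodings of
graphs which (i) is SOUND for arrowing — f(F) = true only if every red/blue colouring of E(F)
contains a monochromatic K₄ (F → (K₄)₂, a coNP property; worst case coNP-complete already for K₃,
Burr 1990) — and (ii) accepts F ∼ G(n, n^{-2/5+δ}) with probability ≥ 1/2 for all large n. By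
Rödl–Ruciński (JAMS 1995, Thm 1 with m₂(K₄) = 5/2; statement checked in Nenadov–Steger
doi:10.1017/s0963548314000832 p.1) arrowing holds with probability → 1 in the whole window, so (ii)
asks nothing a correct decider would not do: X says correctness cannot be had in polynomial time.
Shape = Feige's one-sided refutation hypothesis (tree:
Literature.Computability.Complexity.FeigeHypothesis), but for a GRAPH-INDUCED ensemble (variables =
edges, constraints = the K₄'s of one random graph, predicate NAE₆, no literals) whose truth comes
from a transference/container theorem and not from a first-moment bound, at LINEAR constraint
density Δ = #K₄/#edges = n^{5δ}/12.
Lean (decl RandomRamseyHypothesis, elaborates). G(n,p) := pushforward of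
`Literature.Probability.RandomGraphs.PlantedClique.bernoulliVec (n*n) (min 1 (ENNReal.ofReal p))`
along `SimpleGraph.fromRel (fun i j => i < j ∧ bit (i,j))` — this IS
`Literature.Probability.RandomGraphs.erdosRenyi n p` (`erdosRenyi_eq`, rfl), the model in which the
Rödl–Ruciński 1-statement is PROVED in the tree (`RodlRucinski1995_oneStatement_holds`,
RandomRamseyProofs.lean); inputs coded by `Literature.Computability.Complexity.encodingGraph`;
arrowing written out as `∀ c : Sym2 (Fin n) → Bool, ∃ S, G.IsNClique 4 S ∧ ∃ b, ∀ u ∈ S, ∀ v ∈ S, u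
≠ v → c s(u,v) = b`:
`∀ δ, 0 < δ → δ < 1/15 → ¬ ∃ f, IsPolyTimePred f ∧ (∀ n G, f (encodingGraph.encode ⟨n,G⟩) = true → G
→ (K₄)₂) ∧ ∀ᶠ n in atTop, 1/2 ≤ (G(n, n^{δ-2/5})).toOuterMeasure {G | f (encode ⟨n,G⟩) = true}`.

## Deciding theorem X → PneNP (D-0027 §2.1: `closes : RodlRucinskiK4 → NonArrowingMemNP →
RandomRamseyHypothesis → PneNP`, PROVED sorry-free in this file; the former statement item
`Assembly` with the same content is dropped as superseded)
¬PneNP ⇒ every Wave0-NP language is Wave0-P. NonArrowingMemNP puts NONARROW₄ =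
encodingGraph.toLanguage {⟨n,G⟩ | G ↛ (K₄)₂} in Nondeterministic.NP = PNPWave0.NP Bool (proved
bridge `np_bool_eq`), hence in PNPWave0.P Bool = Classes.P (proved bridge `P_bool_eq_holds`), which
is closed under complement (`compl_mem_P_iff`): a Wave0 poly-time predicate g decides NONARROW₄ᶜ; by
Encoding.mem_toLanguage_iff g accepts the code of ⟨n,G⟩ iff G → (K₄)₂, so g is SOUND and its
acceptance event IS the arrowing event; RodlRucinskiK4 at δ = 1/30 (one line from the literature:
`RodlRucinski1995_oneStatement_holds.K4_window` via `erdosRenyi_eq`) makes that probability → 1,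
hence ≥ 1/2 eventually (Tendsto.eventually + lt_mem_nhds in ENNReal) — contradicting X at δ = 1/30 <
1/15. 50 lines of Lean; the bridges are theorems of the tree, not hypotheses.

## Two-layer plan (D-0019)
Layer 1 (filed now): cruxes SosBlindAboveThreshold (rank 2: SOS of degree n^{Ω(1)} cannot refute
"E(F) has a K₄-free-in-both-colours 2-colouring" in the window) → QuietNonArrowingPlanting (rank 3:
a planted law on NON-arrowing graphs that no poly-time test tells from G(n,p); the wall, dual form
of X) → TriangleArrowingSosEasy (rank 4: the k = 3 control — constant-degree SOS DOES certify G(n,p)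
→ (K₃)₂ from p ≥ polylog/√n). Supports: RodlRucinskiK4 (RR95 Thm 1′ — PROVED in Literature:
`RodlRucinski1995_oneStatement_holds.K4_window`, a one-line item), NonArrowingMemNP (routine
NP-membership, pattern CLIQUE_mem_NP), QuietPlantingImpliesHypothesis (U → X, provable now),
OptimalJumbledK4Free (known: Alon 1994 / Bishnoi–Ihringer–Pepe 2020 Thm 9 — the deterministic
building block of plantings), ApSosBlindAboveThreshold (arithmetic twin: 4-APs in [n]_p at p =
n^{-1/3+δ}), RandomRamseyCertifier (negative side ¬X).
Layer 2 (only after a crux closes, by glued splits): SosBlindAboveThreshold ↦ {defect-tolerant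
Plausibility for the K₄-factor graph of G(n,p) (K₅/K₆ clusters merged into super-constraints), KMOW
closure/Gram–Schmidt on that factor graph}; QuietNonArrowingPlanting ↦ {low-degree quietness of an
explicit overlay planting R ∪ B, spectral quietness via sparsified optimally-jumbled K₄-free colour
classes, the Sₙ-symmetric low-degree-to-P transfer shared with route PlantedClique crux #2}.

Rationale: WHY THIS LINE (widen: probabilistic/extremal combinatorics imported into average-case complexity).
Feige-type hypotheses (route Feige) put P ≠ NP on a product measure whose unsatisfiability is
first-moment visible. Here the ensemble is the arrowing CSP of ONE random graph — variables = edges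
of F ∼ G(n,p), constraints = its K₄'s, predicate NAE₆, no literals — at p = n^{-2/5+δ}, one
polynomial factor above the Rödl–Ruciński threshold n^{-1/m₂(K₄)}
(doi:10.1090/S0894-0347-1995-1276825-6, Thm 1). Four independent facts single this window out: (1)
TRUTH is a transference/container theorem (Nenadov–Steger doi:10.1017/s0963548314000832;
Conlon–Gowers arXiv:1011.4310; Schacht doi:10.4007/annals.2016.184.2.1) — a union bound over
exp(n^{8/5} log n) container pairs, not over assignments; (2) NO LOCAL WITNESS: the sparsest graph
arrowing (K₄)₂ has density (R(4,4)-1)/2 = 8.5 (Kurek–Ruciński doi:10.7151/dmgt.1268, via refuter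
audit; acq-02110), so arrowing subgraphs appear only at p ≥ n^{-2/17}; (3) SEMIDEFINITE BLINDNESS:
NAE₆ supports the 5-wise-uniform odd-weight coset of F₂⁶, so by Kothari–Mori–O'Donnell–Witmer
(arXiv:1701.04521, Thm 2 with C(NAE₆) = 6, and §2.2: the bound holds for ANY factor graph satisfying
the Plausibility Assumption, literals not needed) SOS should need degree ≈ N/Δ^{1/2} = n^{8/5-3δ/2};
(4) the k = 3 CONTROL: NAE₃ supports no pairwise-uniform law, so Allen–O'Donnell–Witmer
(arXiv:1505.04383, Thm p.5, t = 2) / the closing-cherry spectral certificate make K₃-arrowing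
certifiable from p ≥ polylog·n^{-1/2}: same threshold theory, opposite predicted complexity, decided
by one line of Fourier analysis on the predicate. The constant 1/15 is forced twice: δ < 1/15 ⟺
G(n,p) is K₇-free whp and its K₅-defects (which VIOLATE KMOW's Plausibility Assumption: (6-ζ)·5 ≥
2(30-10) fails) are sparse among the n^{8/5+δ} variables; and δ < 1/15 ⟺ sparsifying an optimally
pseudorandom K₄-free graph of density n^{-1/3} (Alon 1994; Bishnoi–Ihringer–Pepe arXiv:1905.04677
Thm 9) down to p keeps λ₂ = (2+o(1))√(np).
RANKED CRUXES. #2 SosBlindAboveThreshold — most informative and provable-looking; fails if K₅/K₆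
defect clusters percolate through KMOW's closure (graph-induced scopes share triangles) or if a
Kikuchi/shared-triangle spectral certificate refutes at density n^{o(1)}. #3
QuietNonArrowingPlanting — the wall in its dual (planted) form: a law on non-arrowing graphs (=
overlays R ∪ B of two K₄-free graphs with all small-subgraph statistics of G(n,p)) fooling every
poly-time test; fails if non-arrowing at density ≫ threshold forces a detectable signature (typical
K₄-free graphs there are near-tripartite, Balogh–Morris–Samotij–Warnke doi:10.1090/tran/6552;
ϑ-function / codegree-variance tests), which would also sink X. #4 TriangleArrowingSosEasy — the
control; fails only through heavy-tailed link spectra near n^{-1/2} (polylog vs n^{ε}) or CNF-degree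
bookkeeping.
KILL CRITERIA. RandomRamseyCertifier (¬X: a sound poly-time certifier at some δ < 1/15) closes the
route — and would found "constructive random Ramsey theory" above the threshold (the constructive
0-statement below it exists: Marciniszyn–Skokan–Spöhel–Steger, APPROX 2006 p.544;
Nenadov–Person–Škorić–Steger doi:10.1016/j.jctb.2016.12.007). ¬SosBlindAboveThreshold
(constant-degree SOS refutes at density n^{o(1)}) demotes the line to the transference ceiling and
we close as exhausted unless QuietNonArrowingPlanting survives in a non-SOS form.
¬TriangleArrowingSosEasy does not kill the route but removes its internal dichotomy check. A
Holmgren–Wein-type counterexample INSIDE the Sₙ-symmetric graph setting kills the planned layer-2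
transfer split (shared fate with route PlantedClique).
DELIBERATELY NOT DECOMPOSED: the low-degree form of quietness (needs a p-biased low-degree norm;
definition request filed), Res/PC width lower bounds for the arrowing tautologies (proof-complexity
rung; Krajíček Problem 13.7.1 context), k ≥ 5 and AP_k ≥ 5 variants, the CFZ upper side (poly-time
certification for p ≥ n^{-γ₄} via certified jumbledness, arXiv:1204.6645), randomized certifiers.
NOVELTY and BARRIERS: see the dedicated fields (searched 2026-08-15: lit hybrid/crossref/galaxy
pdf-bm25; nearest prior = Feige2002 template + KMOW/AOW engines + RR thresholds; new = the window as
a one-sided certification problem, the NAE_{C(k,2)} t-wise-uniformity dichotomy, quiet non-arrowing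
plantings). technique_class: average-case-refutation,sos-lower-bounds,k-wise-independence.

Novelty: NOVELTY (planner, 2026-08-15; searched before claiming: `lit search --hybrid` "Ramsey property
random graph certify refute sum of squares arrowing monochromatic" (local: only Ramsey
textbooks/surveys + MSSS APPROX 2006 p.544 = algorithmic 0-statement), crossref ×4 (Nenadov–Steger,
Kurek–Ruciński, BMS–Warnke, NPŠS17), `lit galaxy search --star all` "Ramsey property of random
graphs" (0 rows), galaxy pdf bm25 "certifying that a random graph is Ramsey / refutation of
colourings / planted colourings / SOS near the Rödl–Ruciński threshold" (15 hits: low-degree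
workshop report, BHKKMP planted clique, Bresler–Jiang, FPV planted CSP, KWB notes arXiv:1907.11636,
Berthet–Ellenberg planted flat-SAT — none on Ramsey properties), `lit frontier PneNP --since 2020` /
`lit bridges PneNP --cross any` (no Ramsey-theoretic descendant), reads of arXiv:1701.04521 (Thm 2,
§2.2 Plausibility), arXiv:1505.04383 (Thm p.5), arXiv:2306.04007 (p.12), arXiv:1905.04677 (Thm 9),
doi:10.1017/s0963548314000832 (Thm 1); plus the card's refuter audit (crossref ×5, zbMATH, galaxy,
arXiv:1108.1102)).
Nearest prior art: (a) the TEMPLATE is Feige2002 §1 Hypothesis 1 (one-sided refutation of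
whp-unsatisfiable random instances ⇒ P ≠ NP; tree:
Literature.Computability.Complexity.FeigeHypothesis, route Feige) and the ENGINES are
Allen–O'Donnell–Witmer arXiv:1505.04383 / Kothari–Mori–O'Donnell–Witmer arXiv:1701.04521
(t-wise-uniformity ⇔ SOS degree) — all for i.i.d. scopes with random literals; (b) the COMPLETENESS
half  [refs: 10.1017/s0963548314000832, 10.1090/S0894-0347-1995-1276825-6, 10.1016/j.jctb.2016.12.007, 1907.11636, 1701.04521, 1505.04383, 2306.04007, 1905.04677, 1108.1102, 1303.3166, doi:10.1017/s0963548314000832, doi:10.1090/S0894-0347-1995-1276825-6, doi:10.1016/j.jctb.2016.12.007, Feige2002]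

Barriers (technique_class: average-case-refutation,sos-lower-bounds,k-wise-independence): technique_class: average-case-refutation,sos-lower-bounds,k-wise-independence (also:
low-degree-method, random-ramsey-transference)
- Literature.Barriers.PneNP.Relativization (with Literature.Barriers.PneNP.BoundedRelativization and
Literature.Barriers.PneNP.Algebrization): APPLY to the target and are relocated, not evaded — the
Assembly relativizes (relative to any O with P^O = NP^O the exact decider is a sound poly-time
certifier and Rödl–Ruciński is oracle-free), so X fails relative to such oracles and any proof of X
(equivalently of crux QuietNonArrowingPlanting against all of P) must be
non-relativizing/non-algebrizing; the route names no such ingredient and says so: that crux is the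
honest wall, shared in kind with routes Feige and PlantedClique. Cruxes SosBlindAboveThreshold and
TriangleArrowingSosEasy are theorems about an explicit measure and an explicit proof system (SOS
degree) and are untouched by oracle barriers.
- Literature.Barriers.PneNP.NaturalProofs: not engaged — no property of truth tables is used; the
lower bounds are for a coNP certification task on random INPUTS against a syntactic certificate
class (SOS degree), and the target is uniform (IsPolyTimePred). A non-uniform reading of X (no
poly-size sound certifier circuits) would imply NP ⊄ P/poly and a constructive-large proof of it
would be blocked given strong PRGs; nothing in the route is of that form.
- Literature.Barriers.PneNP.LowDegreeCounterexamples (Holmgren–Wein Thm 2): bears on the planned lay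

History (route lifecycle, newest last):
- 2026-08-16T02:17:40Z · AUTO-CRUX: 2 conjecture-grade item(s) promoted to crux (RandomRamseyHypothesis, QuietPlantingImpliesHypothesis) — refuter vetting / tiering apply (operator:999:1362873)
- 2026-08-16T04:14:40Z · AUTO-CRUX (backfill): RandomRamseyHypothesis — hypotheses of the deciding theorem that nothing in the route derives are cruxes (operator:999:1085951)
- 2026-08-23T00:22:47Z · DORMANT — reconciler: no traction for 5.8 d (last activity item-evidence-added at 2026-08-17T04:54:01Z); parked, not closed — `ledger route dormant route-PneNP-RamseyThre (operator:999:1959780)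

sub-problem: PneNP · status: dormant · opened planner-plancard-PneNP-PneNP-ramsey-threshold-b3c1a29d-0 2026-08-15T11:00:26Z · rev 6 · ledger route-PneNP-RamseyThreshold
GENERATED by the gate from the ledger (D-0016/17). Provers cite these decls: `theorem foo : Summit.PneNP.PneNP.Theses.RamseyThreshold.<Decl> := …` in Summits/PneNP/PneNP/Theorems/<Name>.lean.
-/

namespace Summit.PneNP.PneNP.Theses.RamseyThreshold

open scoped BigOperators Topology Manifold Classical MeasureTheory ProbabilityTheory Matrix InnerProductSpace ComplexConjugate ContinuousMap
open Filter Set Function TopologicalSpace MeasureTheory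

attribute [summit_statement] _root_.PneNP

open Literature.PNP

/-- item stmt-PneNP-2050 · crux (kind.auto-crux: conjecture-grade) · rank 0 · open · by planner
why it might fail: X ⇒ P≠NP; X dies if ONE sound poly-time certifier accepts G(n,n^{δ-2/5}) w.p. ≥ 1/2 at ONE δ<1/15. Only SOS/spectral classes are even conjecturally excluded (crux #2); a certificate reading graph structure (shared-triangle/Kikuchi matrices, link-graph SDPs, container fingerprints) is not.
sources: RodlRucinski1995 (doi:10.1090/S0894-0347-1995-1276825-6, Thm 1), NenadovSteger2014 (doi:10.1017/s0963548314000832, Thm 1 p.1), Feige2002 (§1 Hypothesis 1; tree Literature.Computability.Complexity.FeigeHypothesis), KothariEtAl2017 (arXiv:1701.04521, Thm 2, §2.2), arXiv:1505.04383 (AOW, Thm p.5), ConlonFoxZhao2014 (arXiv:1204.6645)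
[target] Random-Ramsey Hypothesis RRH₄ (route thesis X; card ramsey-threshold-certification-gap).
For every 0 < δ < 1/15 there is no deterministic polynomial-time predicate f (Wave0
`IsPolyTimePred`, input `encodingGraph.encode ⟨n, G⟩`) that is (i) SOUND for arrowing — f = true
only on graphs all of whose red/blue edge-colourings contain a monochromatic K₄ — and (ii) accepts
G(n, n^{δ-2/5}) with probability ≥ 1/2 for all large n (G(n,p) = `bernoulliVec (n*n) p` pushed along
`SimpleGraph.fromRel`, i.e. each pair {i<j} an edge independently w.p. min(1,p)). One polynomial
factor above the Rödl–Ruciński threshold n^{-1/m₂(K₄)} = n^{-2/5} arrowing holds w.h.p. (RR95 Thm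
1), so a correct decider satisfies (ii); X says none runs in polynomial time. Feige-shaped (cf.
Literature.Computability.Complexity.FeigeHypothesis) but graph-induced: variables = edges,
constraints = the K₄'s of F, predicate NAE₆ (5-wise-uniform supporting), no literals, constraint
density n^{5δ}/12. δ < 1/15 keeps F K₇-free w.h.p. and far below both the local-witness density
n^{-2/17} (sparsest arrowing graph has density 8.5, Kurek–Ruciński) and the CFZ
certified-jumbledness regime. -/
@[route_item "route-PneNP-RamseyThreshold", crux]
def RandomRamseyHypothesis : Prop :=
  ∀ δ : ℝ, 0 < δ → δ < 1 / 15 → ¬ ∃ f : List Bool → Bool, Literature.Computability.Complexity.IsPolyTimePred f ∧ (∀ (n : ℕ) (G : SimpleGraph (Fin n)), f (Literature.Computability.Complexity.encodingGraph.encode ⟨n, G⟩) = true → ∀ c : Sym2 (Fin n) → Bool, ∃ S : Finset (Fin n), G.IsNClique 4 S ∧ ∃ b : Bool, ∀ u ∈ S, ∀ v ∈ S, u ≠ v → c s(u, v) = b) ∧ ∀ᶠ n : ℕ in Filter.atTop, (1 / 2 : ENNReal) ≤ (((Literature.Probability.RandomGraphs.PlantedClique.bernoulliVec (n * n) (min 1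 (ENNReal.ofReal ((n : ℝ) ^ (δ - 2 / 5)))) (min_le_left _ _)).map (fun s => SimpleGraph.fromRel fun i j : Fin n => i < j ∧ s (finProdFinEquiv (i, j)) = true))).toOuterMeasure {G | f (Literature.Computability.Complexity.encodingGraph.encode ⟨n, G⟩) = true}

/-- item stmt-PneNP-2051 · crux · rank 2 · open · by planner
why it might fail: KMOW Thm 2 needs Plausibility (§2.2), violated by the K₄-hypergraph of G(n,p): K₅ = 5 scopes, no unique variable; the odd-parity lift behind NAE₆'s 5-wise uniformity is contradictory on every K₆ (15 eqns, each edge in 6: 0≡15 mod 2), present whp ∀δ>0; a shared-triangle/Kikuchi certificate may refute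
sources: KothariEtAl2017 (arXiv:1701.04521: Thm 2; §2.2 Plausibility Assumption; Remark 1), arXiv:1505.04383 (AOW Thm p.5, tightness §1), doi:10.1016/S0304-3975(00)00157-2 (Grigoriev 2001, parity: the XOR/expansion closure engine), doi:10.1109/FOCS.2008.74 (Schoenebeck 2008; acq-02692), arXiv:2109.04415 (GKM 2022: even-cover/Kikuchi refutation for arbitrary scope hypergraphs — the refuting threat, needs literal randomness we lack), RodlRucinski1995
[crux, rank 2 — most informative, provable-looking] SOS of polynomial degree is blind above the
threshold: for 0 < δ < 1/15 there is c > 0 such that w.h.p. over F ∼ G(n, n^{δ-2/5}) degree-⌊n^c⌋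
Sum-of-Squares FAILS to refute the non-arrowing CNF of F (tree `SOSFailsToRefute`: a degree-d
pseudoexpectation satisfying Booleanity and every clause identity exists). The CNF: variables
x_{u·n+v} = colour of edge {u<v}; for every K₄ S of F the two NAE₆ clauses ⋁_{e⊂S} x_e and ⋁_{e⊂S}
¬x_e. Heuristic (KMOW arXiv:1701.04521 Thm 2 + §2.2): NAE₆ supports the 5-wise-uniform odd-weight
coset of F₂⁶ (it omits 0⁶,1⁶), C(NAE₆) = 6, so on a PLAUSIBLE factor graph degree ≈ N/Δ^{1/2} =
n^{8/5-3δ/2} is needed (N = n^{8/5+δ}/2 edges, Δ = n^{5δ}/12). What must be supplied is new: the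
K₄-factor graph of G(n,p) is NOT plausible (each K₅ = 5 scopes on 10 variables violates (6-ζ)c ≥
2(e-v); n^{1+10δ} K₅'s and n^{15δ} K₆'s occur, no K₇ for δ < 1/15), so the closure/Gram–Schmidt
argument has to be redone with K₅/K₆ clusters merged into super-constraints (merged K₅ predicate
still supports a 3-wise-uniform affine law). If proved, every SOS/SA/spectral arrowing certificate
in the window has size exp(n^{Ω(1)}). -/
@[route_item "route-PneNP-RamseyThreshold"]
def SosBlindAboveThreshold : Prop :=
  ∀ δ : ℝ, 0 < δ → δ < 1 / 15 → ∃ c : ℝ, 0 < c ∧ Filter.Tendsto (fun n : ℕ => (((Literature.Probability.RandomGraphs.PlantedClique.bernoulliVec (n * n) (min 1 (ENNReal.ofReal ((n : ℝ) ^ (δ - 2 / 5)))) (min_le_left _ _)).map (fun s => SimpleGraph.fromRel fun i j : Fin n => i < j ∧ s (finProdFinEquiv (i, j)) = true))).toOuterMeasure {G | Literature.Computability.MetaComplexity.SOSFailsToRefute ⌊(n : ℝ) ^ c⌋₊ (((Finset.univ.filter fun S : Finset (Fin n) => G.IsNClique 4 S).toList.flatMap fun S => [((S ×ˢ S).filter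 fun q : Fin n × Fin n => q.1 < q.2).toList.map fun q => ((q.1 : ℕ) * n + (q.2 : ℕ), true), ((S ×ˢ S).filter fun q : Fin n × Fin n => q.1 < q.2).toList.map fun q => ((q.1 : ℕ) * n + (q.2 : ℕ), false)]))}) Filter.atTop (nhds 1)

/-- item stmt-PneNP-17626 · crux · rank 3 · open · by planner
why it might fail: The wall vs ALL of P (non-relativizing); modulo X₁ it is the →0 form of X. Dies with ONE sound poly-time certifier beyond SOS on G(n,n^{δ-2/5}): algebraic/Gaussian-elimination structure (KMOW p.10: the one known non-SDP refuter), or certified jumbledness (CFZ) reaching the window.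
sources: KothariEtAl2017 (arXiv:1701.04521, §1 p.10: SDP captures all known poly-time refuters except Gaussian elimination; Thm 2), arXiv:1710.05017 (Hopkins–Kothari–Potechin–Raghavendra–Schramm–Steurer 2017, SOS/low-degree optimality heuristic), BarakKindlerSteurer2013 (ITCS 2013: optimality of SDP relaxations for average-case CSPs), Feige2002 (§1 Hypothesis 1), arXiv:1204.6645 (Conlon–Fox–Zhao: the certified-jumbledness threat), Literature.Barriers.PneNP.LowDegreeCounterexamples (Mao2026 / BuhaiEtAl2025 scope)
[piece X₂ of the SOS pincer — NEW crux; the wall in SOS language] Polynomial-degree SOS CAPTURES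
every sound polynomial-time arrowing certifier on the window ensemble: for 0 < δ < 1/15, EVERY c > 0
and every deterministic poly-time f that is SOUND for K₄-arrowing (f = true only on graphs all of
whose 2-edge-colourings have a monochromatic K₄), Pr[f accepts G ∧ degree-⌊n^c⌋ SOS fails to refute
the non-arrowing CNF of G] → 0 over G ∼ G(n, n^{δ-2/5}) — a sound certifier accepts, up to a null
sequence, only where SOS already refutes (the Barak–Kindler–Steurer / KMOW / HKPRSS SOS-optimality
hypothesis, transplanted to this graph-induced ensemble). Glue (proved, attached):
SosBlindAboveThreshold → SosCapturesCertifiers → RandomRamseyHypothesis by the pincer 1/2 ≤ Pr[acc]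
≤ Pr[acc ∧ SOS fails] + (1 - Pr[SOS fails]) → 0. Probes: neither piece gives RandomRamseyHypothesis
or PneNP by exact?/simpa/aesop (4/4 fail); implied by QuietNonArrowingPlanting (registered line
`quiet-planting`). The measure is essential: the instance-wise version (∀ G accepted by a sound
poly-time f, SOS_{n^c} refutes) is expected FALSE via coNP-hardness gadgets + Tulsiani's SOS-gap
transfer + Gaussian elimination on -/
@[route_item "route-PneNP-RamseyThreshold"]
def SosCapturesCertifiers : Prop :=
  ∀ δ : ℝ, 0 < δ → δ < 1 / 15 → ∀ c : ℝ, 0 < c → ∀ f : List Bool → Bool, Literature.Computability.Complexity.IsPolyTimePred f → (∀ (n : ℕ) (G : SimpleGraph (Fin n)), f (Literature.Computability.Complexity.encodingGraph.encode ⟨n, G⟩) = true → ∀ χ : Sym2 (Fin n) → Bool, ∃ S : Finset (Fin n), G.IsNClique 4 S ∧ ∃ b : Bool, ∀ u ∈ S, ∀ v ∈ S, u ≠ v → χ s(u, v) = b) → Filter.Tendsto (fun n : ℕ => (((Literature.Probability.RandomGraphs.PlantedClique.bernoulliVec (n * n) (min 1 (ENNReal.ofReal ((n : ℝ) ^ (δ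 - 2 / 5)))) (min_le_left _ _)).map (fun s => SimpleGraph.fromRel fun i j : Fin n => i < j ∧ s (finProdFinEquiv (i, j)) = true))).toOuterMeasure {G | f (Literature.Computability.Complexity.encodingGraph.encode ⟨n, G⟩) = true ∧ Literature.Computability.MetaComplexity.SOSFailsToRefute ⌊(n : ℝ) ^ c⌋₊ (((Finset.univ.filter fun S : Finset (Fin n) => G.IsNClique 4 S).toList.flatMap fun S => [((S ×ˢ S).filter fun q : Fin n × Fin n => q.1 < q.2).toList.map fun q => ((q.1 : ℕ) * n + (q.2 : ℕ), true), ((S ×ˢ S).filter fun q : Fin n × Fin n => q.1 < q.2).toList.map fun q => ((q.1 : ℕ) * n + (q.2 : ℕ), false)]))}) Filter.atTop (nhds 0)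

/-- item stmt-PneNP-2052 · crux · rank 3 · open · by planner
why it might fail: Dual of X vs ALL of P (non-relativizing). Fails if non-arrowing at p ≫ n^{-2/5} forces a poly-time signature: typical K₄-free graphs there are tripartite (BMSW16 ⇒ generic plantings 9-partite, loud); non-Ramsey graphs near p̂ are structured (FKSS Thm 1.2); ϑ/codegree/count tests kill naive overlays.
sources: BaloghEtAl2016 (doi:10.1090/tran/6552: typical sparse K_{r+1}-free graphs are r-partite for m ≫ n^{2-2/(r+2)} polylog), arXiv:2207.13982 (Friedgut–Kuperwasser–Samotij–Schacht, Thm 1.2: sharp threshold for all cliques via containers + structure of non-colourable H_p; doi:10.1017/fms.2026.10178), Hopkins2018 (Conj. 2.2.4), HolmgrenWein2021 (Thm 2, scope caveat: S_n-symmetric Boolean case open), BishnoiIhringerPepe2020 (arXiv:1905.04677 Thm 9), arXiv:2306.04007 (p.12 open problem)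
[crux, rank 3 — the wall, in its dual (planted) form] Quiet non-arrowing plantings exist: for 0 < δ
< 1/15 there is a sequence of laws Pₙ on graphs on Fin n, SUPPORTED ON NON-ARROWING graphs (some
2-colouring of the pairs leaves no K₄ of G monochromatic, i.e. E(G) = R ∪ B with R, B K₄-free), such
that every polynomial-time predicate has acceptance probability under Pₙ minus that under G(n,
n^{δ-2/5}) tending to 0. Here 'all of P' enters; U → X is support QuietPlantingImpliesHypothesis
(soundness forces acceptance 0 under Pₙ); non-uniformly X ⇒ U by LP duality + boosting, so U is X's
honest dual. It names the new object of the route: overlays R ∪ B of two K₄-free graphs carrying ALL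
small-subgraph statistics of G(n,p) (K₄-count included), built e.g. from sparsified optimally
pseudorandom K₄-free graphs (OptimalJumbledK4Free; λ₂ stays (2+o(1))√(np) iff δ < 1/15) with
corrected codegree/triangle statistics. Layer-2 split: low-degree quietness of an explicit overlay
(p-biased low-degree norm: definition requested) + spectral quietness + the Sₙ-symmetric
low-degree-to-P transfer (route PlantedClique crux #2; Holmgren–Wein spares the symmetric Boolean
case). -/
@[route_item "route-PneNP-RamseyThreshold"]
def QuietNonArrowingPlanting : Prop :=
  ∀ δ : ℝ, 0 < δ → δ < 1 / 15 → ∃ P : (n : ℕ) → PMF (SimpleGraph (Fin n)), (∀ (n : ℕ) (G : SimpleGraph (Fin n)), G ∈ (P n).support → ∃ c : Sym2 (Fin n) → Bool, ∀ S : Finset (Fin n), G.IsNClique 4 S → ∀ b : Bool, ∃ u ∈ S, ∃ v ∈ S, u ≠ v ∧ c s(u, v) ≠ b) ∧ ∀ f : List Bool → Bool, Literature.Computability.Complexity.IsPolyTimePred f → Filter.Tendsto (fun n : ℕ => ((P n).toOuterMeasure {G | f (Literature.Computability.Complexity.encodingGraph.encode ⟨n, G⟩) = true}).toReal - ((((Literature.Probability.RandomGraphs.PlantedClique.bernoulliVec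 (n * n) (min 1 (ENNReal.ofReal ((n : ℝ) ^ (δ - 2 / 5)))) (min_le_left _ _)).map (fun s => SimpleGraph.fromRel fun i j : Fin n => i < j ∧ s (finProdFinEquiv (i, j)) = true))).toOuterMeasure {G | f (Literature.Computability.Complexity.encodingGraph.encode ⟨n, G⟩) = true}).toReal) Filter.atTop (nhds 0)

/-- item stmt-PneNP-2056 · crux (kind.auto-crux: conjecture-grade) · rank 9 · closed · proved by Summit.PneNP.PneNP.Theorems.ramseyThreshold_quietPlantingImpliesHypothesis_proof @ b3bb9aa35a15 (prover) · by planner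
why it might fail: auto-crux — conjecture-grade statement (name 'QuietPlantingImpliesHypothesis' says conjecture/hypothesis); it is open, so it may simply be false
sources: Feige2002 (§1: refutation vs. distinguishing)
[support — glue, provable now] U → X: if f is a sound certifier accepting G(n, n^{δ-2/5}) with
probability ≥ 1/2 eventually, then under any planting Pₙ supported on non-arrowing graphs soundness
gives acceptance probability 0 (PMF.toOuterMeasure of a set disjoint from the support), so the
acceptance gap is ≥ 1/2 eventually and cannot tend to 0. Pure measure bookkeeping
(PMF.toOuterMeasure_apply_eq_zero_iff, ENNReal.toReal). -/
@[route_item "route-PneNP-RamseyThreshold"]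
def QuietPlantingImpliesHypothesis : Prop :=
  QuietNonArrowingPlanting → RandomRamseyHypothesis

/-- item stmt-PneNP-2053 · support · rank 4 · open · by planner
why it might fail: Only bookkeeping: links G(np,p) need np² ≫ log n for λ_min = -O(√(np²)) (∃C grants it); the tree's clause identities are vacuous for d < clause width, so take d ≥ 6 (∃d grants it).
sources: arXiv:1505.04383 (AOW Thm p.5, t=2; §4.3), doi:10.1002/rsa.20089 (Feige–Ofek 2005 spectral norm of sparse G(m,p); acq-02693), RodlRucinski1995 (K₃ threshold n^{-1/2}), Literature.Computability.Complexity.AOWRefutation (tree), Literature.Computability.MetaComplexity.SumOfSquares (SOSFailsToRefute, SatisfiesIdentity)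
[crux, rank 4 — the k = 3 control] Constant-degree SOS certifies TRIANGLE-arrowing a polylog factor
above its Rödl–Ruciński threshold n^{-1/m₂(K₃)} = n^{-1/2}: there are d ∈ ℕ and C such that for
every edge-probability sequence with (log n)^C/√n ≤ p(n) ≤ 1 eventually, w.h.p. degree-d SOS REFUTES
the non-arrowing CNF for K₃ of G(n,p) (same clause scheme: for each triangle the clauses ⋁ x_e, ⋁
¬x_e). Mechanism: NAE₃ supports NO pairwise-uniform law (1_{NAE}(x,y,z) = 3/4 - (xy+yz+zx)/4), so a
good colouring χ ∈ {±1}^{E(F)} would give χᵀAχ = -2T with A_{ef} = 1[e, f span a triangle of F] and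
T = #triangles ≈ n³p³/6, while A = Σ_v A(F[N(v)]) has λ_min ≥ -(4+o(1))√(np²) once np² ≫ log n; -2T
< λ_min·N exactly when p ≫ n^{-1/2}: a degree-2 (Goodman-type / Allen–O'Donnell–Witmer t = 2)
certificate. Same threshold theory and random model as the K₄ case, opposite predicted complexity,
decided by t-wise uniformity of NAE_{C(k,2)} (k = 3: none pairwise; k ≥ 4: (≥3)-wise) — the route's
internal falsifiable dichotomy; kit-checkable on small n. -/
@[route_item "route-PneNP-RamseyThreshold"]
def TriangleArrowingSosEasy : Prop :=
  ∃ (d : ℕ) (C : ℝ), ∀ p : ℕ → ℝ, (∀ᶠ n : ℕ in Filter.atTop, Real.log n ^ C / Real.sqrt n ≤ p n ∧ p n ≤ 1) → Filter.Tendsto (fun n : ℕ => (((Literature.Probability.RandomGraphs.PlantedClique.bernoulliVec (n * n) (min 1 (ENNReal.ofReal (p n))) (min_le_left _ _)).map (fun s => SimpleGraph.fromRel fun i j : Fin n => i < j ∧ s (finProdFinEquiv (i, j)) = true))).toOuterMeasure {G | ¬ Literature.Computability.MetaComplexity.SOSFailsToRefute d (((Finset.univ.filter fun S : Finset (Fin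 n) => G.IsNClique 3 S).toList.flatMap fun S => [((S ×ˢ S).filter fun q : Fin n × Fin n => q.1 < q.2).toList.map fun q => ((q.1 : ℕ) * n + (q.2 : ℕ), true), ((S ×ˢ S).filter fun q : Fin n × Fin n => q.1 < q.2).toList.map fun q => ((q.1 : ℕ) * n + (q.2 : ℕ), false)]))}) Filter.atTop (nhds 1)

/-- item stmt-PneNP-17642 · support · rank 9 · open · by planner
sources: arXiv:1701.04521 (KMOW, Thm 2, §1 p.10), Feige2002 (§1)
[support — GLUE of the strategist's typed decomposition (BC2 redirect) of the deciding crux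
RandomRamseyHypothesis; PROVED sorry-free, proof attached as evidence on this item and on
stmt-PneNP-2050 (RamseyThresholdRandomRamseyHypothesisSplit.lean; axioms
propext/Classical.choice/Quot.sound), to be landed verbatim by any prover as `theorem … :
Summit.PneNP.PneNP.Theses.RamseyThreshold.RandomRamseyHypothesisOfSosPincer` — Theorems is
prover-only for the strategist seat] The SOS PINCER: given a sound poly-time f accepting G(n,
n^{δ-2/5}) with probability ≥ 1/2 eventually, SosBlindAboveThreshold gives c > 0 with Pr[SOS_{⌊n^c⌋}
fails to refute the non-arrowing CNF] → 1, SosCapturesCertifiers at that c gives Pr[f acc ∧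
SOS_{⌊n^c⌋} fails] → 0, and the estimate Pr[acc] ≤ Pr[acc ∧ fails] + (1 − Pr[fails]) (PMF complement
+ union bound in ℝ≥0∞) tends to 0, contradicting 1/2 ≤ Pr[acc] eventually. ≈35 lines. Once landed,
`route edit --split RandomRamseyHypothesis --into children.json --glue-by <it>` makes the two pieces
the route's leaves (children.json in the strategist's crux dir). -/
@[route_item "route-PneNP-RamseyThreshold"]
def RandomRamseyHypothesisOfSosPincer : Prop :=
  SosBlindAboveThreshold → SosCapturesCertifiers → RandomRamseyHypothesis

/-- item stmt-PneNP-2054 · support · rank 9 · open · by planner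
sources: doi:10.1090/S0894-0347-1995-1276825-6 (Thm 1), doi:10.1017/s0963548314000832 (Thm 1 p.1, proof §2)
[support — KNOWN THEOREM, the completeness half; vendor as a Literature named fact or formalise]
Rödl–Ruciński 1995, Thm 1 (1-statement) for F = K₄, r = 2, read at p = n^{δ-2/5}, 0 < δ < 2/5:
Pr[G(n, n^{δ-2/5}) → (K₄)₂] → 1 (m₂(K₄) = (6-1)/(4-2) = 5/2, and n^δ ≥ C eventually; arrowing is
monotone). Statement checked against Nenadov–Steger (CPC 2016) Thm 1, p.1, whose container proof
(Saxton–Thomason / Balogh–Morris–Samotij + supersaturated Ramsey) is the shortest in print (~4 pp.).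
Used by the Assembly at δ = 1/30. A cite item asks the librarian to vendor `rodlRucinski_threshold`
in Literature; until then this decl is the hypothesis. -/
@[route_item "route-PneNP-RamseyThreshold", crux]
def RodlRucinskiK4 : Prop :=
  ∀ δ : ℝ, 0 < δ → δ < 2 / 5 → Filter.Tendsto (fun n : ℕ => (((Literature.Probability.RandomGraphs.PlantedClique.bernoulliVec (n * n) (min 1 (ENNReal.ofReal ((n : ℝ) ^ (δ - 2 / 5)))) (min_le_left _ _)).map (fun s => SimpleGraph.fromRel fun i j : Fin n => i < j ∧ s (finProdFinEquiv (i, j)) = true))).toOuterMeasure {G | ∀ c : Sym2 (Fin n) → Bool, ∃ S : Finset (Fin n), G.IsNClique 4 S ∧ ∃ b : Bool, ∀ u ∈ S, ∀ v ∈ S, u ≠ v → c s(u, v) = b}) Filter.atTop (nhds 1)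

/-- item stmt-PneNP-2055 · support · rank 9 · closed · proved by Summit.PneNP.PneNP.Theorems.ramseyThreshold_nonArrowingMemNP_proof @ 5fb3cf6f86ea (prover) · by planner
sources: Karp1972, Literature.Computability.Complexity.KarpCliqueNP (CLIQUE_mem_NP), doi:10.1007/978-3-642-72905-8_5 (Burr 1990: arrowing coNP-complete, calibration)
[support — routine in print, laborious in Lean] NONARROW₄ ∈ NP: the language of (encodingGraph-codes
of) finite graphs ⟨n, G⟩ admitting a 2-colouring of the vertex pairs under which no K₄ of G is
monochromatic is in Nondeterministic.NP — certificate = the colouring restricted to pairs (n² bits),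
verifier = enumerate the O(n⁴) four-sets. Pattern:
Literature.Computability.Complexity.HAMCIRCUIT_mem_NP / CLIQUE_mem_NP (same encodingGraph), via
npLang_mem_NP-style reference languages. Needed by the Assembly (with the proved bridges
NP_bool_eq_holds, P_bool_eq_holds, co_P_holds) to turn ¬PneNP into a Wave0 poly-time ARROWING
decider. -/
@[route_item "route-PneNP-RamseyThreshold", crux]
def NonArrowingMemNP : Prop :=
  Literature.Computability.Complexity.encodingGraph.toLanguage {G : Σ n, SimpleGraph (Fin n) | ∃ c : Sym2 (Fin G.1) → Bool, ∀ S : Finset (Fin G.1), G.2.IsNClique 4 S → ∀ b : Bool, ∃ u ∈ S, ∃ v ∈ S, u ≠ v ∧ c s(u, v) ≠ b} ∈ Literature.Computability.Complexity.Nondeterministic.NP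

/-- item stmt-PneNP-2057 · support · rank 9 · open · by planner
sources: arXiv:1905.04677 (Thm 9, §1), arXiv:2306.04007 (p.12), KrivelevichSudakov2006 (expander mixing; pseudo-random graphs survey)
[support — KNOWN (Alon 1994 triangle-free; Bishnoi–Ihringer–Pepe 2020 Thm 9: K_k-free (n,d,λ)-graphs
with n = Θ(q^{k-1}), d = Θ(q^{k-2}), λ = q^{(k-2)/2}, i.e. density Θ(n^{-1/(k-1)}) = n^{-1/3} ≥
n^{-2/5} for k = 4) + expander mixing lemma + passing to all large n by random induced subgraphs]
For all large n there is a K₄-free graph on Fin n of some density p ≥ n^{-2/5} that is (p,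
C√(np))-jumbled: |e(X,Y) - p|X||Y|| ≤ C√(np)√(|X||Y|) for all vertex sets (ordered pair count).
Role: the deterministic building block of quiet plantings — sparsifying it to density n^{δ-2/5}
keeps the top of the spectrum at (2+o(1))√(np) iff δ < 1/15 — and the 'transference ceiling': no
certificate reading only jumbledness at the G(n,p) scale can even certify 'contains K₄'. The OPTIMAL
density n^{-1/5} (Mattheus–Verstraëte 2024, p.12) is open and NOT asked here. -/
@[route_item "route-PneNP-RamseyThreshold"]
def OptimalJumbledK4Free : Prop :=
  ∃ C : ℝ, ∀ᶠ n : ℕ in Filter.atTop, ∃ (p : ℝ) (G : SimpleGraph (Fin n)), (n : ℝ) ^ (-(2 : ℝ) / 5) ≤ p ∧ G.CliqueFree 4 ∧ ∀ X Y : Finset (Fin n), |(((X ×ˢ Y).filter fun q : Fin n × Fin n => G.Adj q.1 q.2).card : ℝ) - p * X.card * Y.card| ≤ C * Real.sqrt (n * p) * Real.sqrt (X.card * Y.card)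

/-- item stmt-PneNP-2058 · support · rank 9 · open · by planner
sources: doi:10.1112/S0024611597000178, arXiv:1701.04521 (Thm 2), doi:10.4007/annals.2016.184.2.1
[support — arithmetic twin of crux #2, cleaner factor graph] van der Waerden version: for 0 < δ <
1/15 there is c > 0 such that w.h.p. over the binomial random subset S = [n]_p (bits `bernoulliVec n
p`), p = n^{δ-1/3} — one polynomial factor above the Rödl–Ruciński/Schacht threshold n^{-1/(k-1)}
for k = 4 — degree-⌊n^c⌋ SOS fails to refute the CNF 'S has a 2-colouring with no monochromatic
4-term arithmetic progression' (variables = integers a < n; for each 4-AP a, a+d, a+2d, a+3d ⊆ S, d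
≥ 1, the clauses ⋁ x and ⋁ ¬x). NAE₄ supports the 3-wise-uniform odd-weight coset of F₂⁴, C(NAE₄) =
4, predicted degree ≈ N/Δ = n^{2/3-2δ}; the AP-factor graph has no clique-type defect clusters (two
4-APs share ≤ 3 points and long overlapping chains are rare), so KMOW's Plausibility Assumption
should hold nearly verbatim — the natural first place for a prover to succeed. Completeness side:
Rödl–Ruciński 1997 (doi:10.1112/S0024611597000178); transference in tree:
Literature.Combinatorics.Additive.RelativeSzemeredi. -/
@[route_item "route-PneNP-RamseyThreshold"]
def ApSosBlindAboveThreshold : Prop :=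
  ∀ δ : ℝ, 0 < δ → δ < 1 / 15 → ∃ c : ℝ, 0 < c ∧ Filter.Tendsto (fun n : ℕ => (Literature.Probability.RandomGraphs.PlantedClique.bernoulliVec n (min 1 (ENNReal.ofReal ((n : ℝ) ^ (δ - 1 / 3)))) (min_le_left _ _)).toOuterMeasure {s | Literature.Computability.MetaComplexity.SOSFailsToRefute ⌊(n : ℝ) ^ c⌋₊ (((((Finset.range n) ×ˢ (Finset.range n)).filter fun q : ℕ × ℕ => 0 < q.2 ∧ ∀ i < 4, ∃ h : q.1 + i * q.2 < n, s ⟨q.1 + i * q.2, h⟩ = true).toList.flatMap fun q => [(List.range 4).map fun i => (q.1 + i * q.2, true), (List.range 4).map fun i => (q.1 + i * q.2, false)]))}) Filter.atTop (nhds 1)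

/-- item stmt-PneNP-2122 · support · rank 9 · open · by planner
[support] Negative side, filed so the refuting direction has a named target: ¬X pushed inside — some
0 < δ < 1/15 admits a deterministic polynomial-time SOUND arrowing certifier (f = true only on
graphs F with F → (K₄)₂) accepting G(n, n^{δ-2/5}) with probability ≥ 1/2 for all large n. Proving
it CLOSES the route (kill criterion) and would found 'constructive random Ramsey theory' above the
threshold — the constructive 0-statement below the threshold is known
(Marciniszyn–Skokan–Spöhel–Steger, APPROX 2006, p.544; Nenadov–Person–Škorić–Steger 2017,
doi:10.1016/j.jctb.2016.12.007), the constructive 1-statement is not. Candidate engines and where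
they currently stop: certified jumbledness + Conlon–Fox–Zhao sparse counting (arXiv:1204.6645) needs
p ≥ n^{-γ₄} with γ₄ far below 2/5; arrowing subgraphs (K₁₈, Folkman graphs) need p ≥ n^{-2/17};
container families have exp(n^{8/5}) members. A Lean proof needs an explicit TM2 poly-time witness
(cf. Literature.Computability.Complexity AKS/AOW machine files). [sources:
doi:10.1016/j.jctb.2016.12.007; arXiv:1204.6645; doi:10.1090/S0894-0347-1995-1276825-6] -/
@[route_item "route-PneNP-RamseyThreshold"]
def RandomRamseyCertifier : Prop :=
  ∃ δ : ℝ, 0 < δ ∧ δ < 1 / 15 ∧ ∃ f : List Bool → Bool, Literature.Computability.Complexity.IsPolyTimePred f ∧ (∀ (n : ℕ) (G : SimpleGraph (Fin n)), f (Literature.Computability.Complexity.encodingGraph.encode ⟨n, G⟩) = true → ∀ c : Sym2 (Fin n) → Bool, ∃ S : Finset (Fin n), G.IsNClique 4 S ∧ ∃ b : Bool, ∀ u ∈ S, ∀ v ∈ S, u ≠ v → c s(u, v) = b) ∧ ∀ᶠ n : ℕ in Filter.atTop, (1 / 2 : ENNReal) ≤ (((Literature.Probability.RandomGraphs.PlantedClique.bernoulliVec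 (n * n) (min 1 (ENNReal.ofReal ((n : ℝ) ^ (δ - 2 / 5)))) (min_le_left _ _)).map (fun s => SimpleGraph.fromRel fun i j : Fin n => i < j ∧ s (finProdFinEquiv (i, j)) = true))).toOuterMeasure {G | f (Literature.Computability.Complexity.encodingGraph.encode ⟨n, G⟩) = true}

/-- item stmt-PneNP-2059 · assembly · rank 1 · closed · proved by Summit.PneNP.PneNP.Theorems.ramseyThreshold_assembly_proof @ c93395da820c (prover) · by planner
sources: Cook1971, Literature.Computability.Complexity.ClayProblem (P_bool_eq_holds, NP_bool_eq_holds), Literature.Computability.Complexity.Classes (co_P_holds)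
[assembly] RodlRucinskiK4 → NonArrowingMemNP → RandomRamseyHypothesis → PneNP. Proof (glue):
by_contra ¬PneNP, so every L ∈ PNPWave0.NP Bool lies in PNPWave0.P Bool; NonArrowingMemNP +
NP_bool_eq_holds put NONARROW₄ there; P_bool_eq_holds + co_P_holds give its complement in PNPWave0.P
Bool, i.e. a Wave0 IsPolyTimePred f with f w = true ↔ w ∉ NONARROW₄; on codes,
Encoding.mem_toLanguage_iff makes f SOUND for arrowing (classical: ¬∃ good colouring ↔ every
colouring has a mono K₄); RodlRucinskiK4 at δ = 1/30 gives Pr[f accepts G(n, n^{-11/30})] =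
Pr[arrowing] → 1, hence ≥ 1/2 eventually (Filter.Tendsto.eventually + order bookkeeping in ENNReal);
this contradicts RandomRamseyHypothesis at δ = 1/30 < 1/15. All bridges used are PROVED theorems of
the tree (ClayProblem/ClayProblemProofs/Classes), so they are not hypotheses here. -/
@[route_item "route-PneNP-RamseyThreshold"]
def Assembly : Prop :=
  RodlRucinskiK4 → NonArrowingMemNP → RandomRamseyHypothesis → PneNP

/-! D-0027 §2.1 — DECIDING THEOREM (planner-authored via `route open/edit --closes-file`; by planner-rbadge-PneNP-RamseyThreshold-78f16950-g2-0 2026-08-15T16:19:29Z):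
its hypotheses are this route's items and its conclusion the sub-problem Statement (glue_lint), and it elaborates with this file. -/

@[closes "route-PneNP-RamseyThreshold"] theorem closes (hRR : RodlRucinskiK4) (hNP : NonArrowingMemNP) (hX : RandomRamseyHypothesis) : PneNP := by
  classical
  by_contra hne
  -- (1) ¬PneNP: every Wave0-NP language is Wave0-P
  have hall : ∀ L : Language Bool, L ∈ Literature.Computability.Complexity.PNPWave0.NP Bool →
      L ∈ Literature.Computability.Complexity.PNPWave0.P Bool := by
    intro L hL
    by_contra hL'
    exact hne ⟨L, hL, hL'⟩
  -- the proved model bridges (theorems of the tree, not hypotheses)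
  have hP : Literature.Computability.Complexity.PNPWave0.P Bool = Literature.Computability.Complexity.Classes.P :=
    Literature.Computability.Complexity.P_bool_eq_holds
  have hN : Literature.Computability.Complexity.PNPWave0.NP Bool = Literature.Computability.Complexity.Nondeterministic.NP :=
    Literature.Computability.Complexity.np_bool_eq
  -- (2) NONARROW₄ ∈ P, hence its complement is in P: a Wave0 poly-time predicate g
  set NONARROW : Language Bool := Literature.Computability.Complexity.encodingGraph.toLanguage {G : Σ n, SimpleGraph (Fin n) | ∃ c : Sym2 (Fin G.1) → Bool, ∀ S : Finset (Fin G.1), G.2.IsNClique 4 S → ∀ b : Bool, ∃ u ∈ S, ∃ v ∈ S, u ≠ v ∧ c s(u, v) ≠ b} with hNONARROW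
  have h1 : NONARROW ∈ Literature.Computability.Complexity.PNPWave0.NP Bool := by
    rw [hN]; exact hNP
  have h2 : NONARROW ∈ Literature.Computability.Complexity.Classes.P := by
    rw [← hP]; exact hall _ h1
  have h3 : NONARROWᶜ ∈ Literature.Computability.Complexity.PNPWave0.P Bool := by
    rw [hP]; exact Literature.Computability.Complexity.compl_mem_P_iff.2 h2
  obtain ⟨g, hg, hgiff⟩ := h3
  -- (3) g accepts the code of ⟨n, G⟩ iff G → (K₄)₂
  have hacc : ∀ (n : ℕ) (G : SimpleGraph (Fin n)), g (Literature.Computability.Complexity.encodingGraph.encode ⟨n, G⟩) = true ↔ ∀ c : Sym2 (Fin n) → Bool, ∃ S : Finset (Fin n), G.IsNClique 4 S ∧ ∃ b : Bool, ∀ u ∈ S, ∀ v ∈ S, u ≠ v → c s(u, v) = b := by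
    intro n G
    rw [← hgiff]
    change Literature.Computability.Complexity.encodingGraph.encode ⟨n, G⟩ ∉ NONARROW ↔ _
    rw [hNONARROW, Computability.Encoding.mem_toLanguage_iff]
    simp only [Set.mem_setOf_eq, not_exists, not_forall, not_and, not_not, ne_eq]
    constructor
    · intro h c
      obtain ⟨S, hS, b, hb⟩ := h c
      exact ⟨S, hS, b, fun u hu v hv huv => hb u hu v hv huv⟩
    · intro h c
      obtain ⟨S, hS, b, hb⟩ := h c
      exact ⟨S, hS, b, fun u hu v hv huv => hb u hu v hv huv⟩
  have hsound : ∀ (n : ℕ) (G : SimpleGraph (Fin n)), g (Literature.Computability.Complexity.encodingGraph.encode ⟨n, G⟩) = true → ∀ c : Sym2 (Fin n) → Bool, ∃ S : Finset (Fin n), G.IsNClique 4 S ∧ ∃ b : Bool, ∀ u ∈ S, ∀ v ∈ S, u ≠ v → c s(u, v) = b :=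
    fun n G => (hacc n G).1
  have hset : ∀ n : ℕ, {G : SimpleGraph (Fin n) | g (Literature.Computability.Complexity.encodingGraph.encode ⟨n, G⟩) = true} = {G | ∀ c : Sym2 (Fin n) → Bool, ∃ S : Finset (Fin n), G.IsNClique 4 S ∧ ∃ b : Bool, ∀ u ∈ S, ∀ v ∈ S, u ≠ v → c s(u, v) = b} :=
    fun n => Set.ext fun G => hacc n G
  -- (4) Rödl–Ruciński at δ = 1/30: acceptance probability → 1, so ≥ 1/2 eventually
  have hδ0 : (0 : ℝ) < 1 / 30 := by norm_num
  have hδ1 : (1 / 30 : ℝ) < 1 / 15 := by norm_num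
  have hδ2 : (1 / 30 : ℝ) < 2 / 5 := by norm_num
  have h12 : (1 / 2 : ENNReal) < 1 := ENNReal.half_lt_self one_ne_zero ENNReal.one_ne_top
  have hT := (hRR (1 / 30) hδ0 hδ2).eventually (lt_mem_nhds h12)
  have hev : ∀ᶠ n : ℕ in Filter.atTop, (1 / 2 : ENNReal) ≤ (((Literature.Probability.RandomGraphs.PlantedClique.bernoulliVec (n * n) (min 1 (ENNReal.ofReal ((n : ℝ) ^ ((1 / 30 : ℝ) - 2 / 5)))) (min_le_left _ _)).map (fun s => SimpleGraph.fromRel fun i j : Fin n => i < j ∧ s (finProdFinEquiv (i, j)) = true))).toOuterMeasure {G | g (Literature.Computability.Complexity.encodingGraph.encode ⟨n, G⟩) = true} := by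
    filter_upwards [hT] with n hn
    rw [hset n]
    exact hn.le
  -- (5) contradiction with X at δ = 1/30 < 1/15
  exact hX (1 / 30) hδ0 hδ1 ⟨g, hg, hsound, hev⟩

end Summit.PneNP.PneNP.Theses.RamseyThreshold
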